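import Mathlib
import HarnessLib

/-!
# [OURS · L1 W4.5(b) · EL♮(3)] B6c ★ T-PKG-FRAME, ring brick: REGROUPING a centred form `Φ ∈ O[T₀,T₁,T₂]` (all monomials with
# `α₁ + α₂ ≥ m`) as a form `Φ′ ∈ A[Z₁,Z₂]` of degree EXACTLY `m` in the chart coordinates, with `Φ′(u) = Φ(1, u₁, u₂)` and
# `Φ′ mod 𝔪_A ≠ 0` when some monomial with `α₁ + α₂ = m` has a unit coefficient
# (crux `EquisingularLiftNatThree` stmt-ResolutionOfSingularities-20148 / parent 20038; rung v7 TC⁺, brick `inv_base` B6c)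

NOT a statement of any manuscript. Helper file of the chain res-L1-w45b (cell `res-hironaka`, LADDER-RESOLUTION rung L, slot W4.5(b));
OURS; AI-written, weaker than expert review; `--supports stmt-ResolutionOfSingularities-20148 --as helper` by res-L1-w45b-stub-3 (object B6c ★
T-PKG-FRAME of the inv_base board, res-L1-w45b-plan-1 BOOKING 2026-08-27T14:59:15Z). No `sorry`; standard axioms. It closes nothing by itself.

WHAT. The cone form of res-L1-w45b-stub-1's `TCPlus.CentredPackage` (…NatSubchainSupplierInvDefs, p532383) at the cone point `p_c` is a form
`Φ′ ∈ 𝒪_{p_c}[Z₁,Z₂]_m` with `K_{p_c} = (Φ′(u₁,u₂))`, `Φ′ mod 𝔪 ≠ 0`. res-type-100's B4a (`exists_centredConeLift_three`, p540528) delivers the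
in-carrier cone as `Φ ∈ O[T₀,T₁,T₂]_d` CENTRED at `[1:0:0]`: `∀ α ∈ supp Φ, m ≤ α₁ + α₂`, whose germ at `p_c` is `Φ(1, u₁, u₂)` with the chart
coordinates `u_l ∈ 𝔪_{p_c}`. This file regroups:

* **`exists_regroup_centred`** — `κ : O → A` a ring map into a local ring, `u₁, u₂ ∈ 𝔪_A`, `Φ` homogeneous of degree `d` with
  `α₁ + α₂ ≥ m` on its support, and ONE exponent `α` in the support with `α₁ + α₂ = m` and `κ(coeff_α Φ)` a unit ⟹ there is
  `Φ′ ∈ A[Z₁,Z₂]`, homogeneous of degree `m`, with `Φ′(u) = Φ^κ(1, u₁, u₂)` and `Φ′ mod 𝔪_A ≠ 0`. Construction: the monomial `a_α T^α`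
  goes to `κ(a_α)·u₁^{α₁−β₁}·u₂^{α₂−β₂}·Z^β` with `β = (min(α₁,m), m − min(α₁,m)) ≤ (α₁,α₂)`; the `Z^{(α₁,α₂)}`-coefficient for the exact
  `α` is `κ(a_α)` plus terms carrying a positive power of some `u_l` (two support exponents with the same `(α₁,α₂)` coincide by homogeneity),
  hence a unit.
* `map_quotient_ne_zero_of_map_residue_ne_zero` — `Φ′ mod 𝔪_A ≠ 0 ⟹ Φ′ mod I ≠ 0` for every proper ideal `I`.

References: H. Matsumura, *Commutative Ring Theory* (1986), §14 (forms and multiplicity) [cite: Matsumura1987]. Pure algebra.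
-/

set_option linter.dupNamespace false -- mandated namespace `Summit.<Summit>.<Problem>` of this single-conjunct summit

noncomputable section

namespace Summit.ResolutionOfSingularities.ResolutionOfSingularities.Cruxes.EquisingularLiftNat.Sections.TCPlus

open MvPolynomial IsLocalRing

variable {O A : Type*} [CommRing O] [CommRing A]

/-- In a form of degree `d`, the exponent of `T₀` is determined by the other two. [folklore] -/
theorem apply_zero_add_eq_of_isHomogeneous {d : ℕ} {Φ : MvPolynomial (Fin 3) O} (hΦd : Φ.IsHomogeneous d)
    {α : Fin 3 →₀ ℕ} (hα : α ∈ Φ.support) : α 0 + α 1 + α 2 = d := by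
  have h := hΦd (mem_support_iff.mp hα)
  simp only [Finsupp.weight_apply, Pi.one_apply, smul_eq_mul, mul_one, Finsupp.sum_fintype, Fin.sum_univ_three,
    implies_true] at h
  exact h

/-- **Regrouping a centred form as a form of exact degree `m` in the chart coordinates.** See the module docstring.
[cite: Matsumura1987, §14] [OURS · L1 W4.5b] B6c brick; NOT a statement of the manuscript. -/
theorem exists_regroup_centred [IsLocalRing A] (κ : O →+* A) (u : Fin 2 → A) (hu : ∀ l, u l ∈ maximalIdeal A)
    {d m : ℕ} (Φ : MvPolynomial (Fin 3) O) (hΦd : Φ.IsHomogeneous d) (hcen : ∀ α ∈ Φ.support, m ≤ α 1 + α 2)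
    (hexact : ∃ α ∈ Φ.support, α 1 + α 2 = m ∧ IsUnit (κ (Φ.coeff α))) :
    ∃ Φ' : MvPolynomial (Fin 2) A, Φ'.IsHomogeneous m ∧
      MvPolynomial.eval u Φ' = MvPolynomial.aeval (![1, u 0, u 1] : Fin 3 → A) (MvPolynomial.map κ Φ) ∧
      MvPolynomial.map (IsLocalRing.residue A) Φ' ≠ 0 := by
  classical
  -- exponent bookkeeping: `β α = (min(α₁,m), m − min(α₁,m))`, leftovers `g₀ α`, `g₁ α`
  let b₀ : (Fin 3 →₀ ℕ) → ℕ := fun α => min (α 1) m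
  let β : (Fin 3 →₀ ℕ) → (Fin 2 →₀ ℕ) := fun α => Finsupp.single 0 (b₀ α) + Finsupp.single 1 (m - b₀ α)
  let g₀ : (Fin 3 →₀ ℕ) → ℕ := fun α => α 1 - b₀ α
  let g₁ : (Fin 3 →₀ ℕ) → ℕ := fun α => α 2 - (m - b₀ α)
  let cf : (Fin 3 →₀ ℕ) → A := fun α => κ (Φ.coeff α) * u 0 ^ g₀ α * u 1 ^ g₁ α
  have hβ0 : ∀ α, β α 0 = b₀ α := fun α => by simp [β]
  have hβ1 : ∀ α, β α 1 = m - b₀ α := fun α => by simp [β]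
  have hb₀le : ∀ α, b₀ α ≤ m := fun α => min_le_right _ _
  have hdegβ : ∀ α, (β α).degree = m := fun α => by
    simp only [β, map_add, Finsupp.degree_single]
    exact Nat.add_sub_cancel' (hb₀le α)
  have hsum : ∀ α ∈ Φ.support, b₀ α + g₀ α = α 1 ∧ (m - b₀ α) + g₁ α = α 2 := fun α hα => by
    have h := hcen α hα
    constructor
    · simp only [b₀, g₀]; omega
    · simp only [b₀, g₁]; omega
  refine ⟨∑ α ∈ Φ.support, monomial (β α) (cf α), ?_, ?_, ?_⟩
  · -- homogeneous of degree `m`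
    refine IsHomogeneous.sum _ _ _ fun α _ => isHomogeneous_monomial _ ?_
    exact hdegβ α
  · -- evaluation at `u`
    rw [map_sum, MvPolynomial.aeval_def, MvPolynomial.eval₂_map, MvPolynomial.eval₂_eq']
    refine Finset.sum_congr rfl fun α hα => ?_
    obtain ⟨h1, h2⟩ := hsum α hα
    rw [MvPolynomial.eval_monomial, Finsupp.prod_fintype _ _ (fun i => by rw [pow_zero]), Fin.prod_univ_two,
      Fin.prod_univ_three, hβ0, hβ1]
    simp only [cf, RingHom.comp_apply, Algebra.algebraMap_self, RingHom.id_apply, Matrix.cons_val_zero, Matrix.cons_val_one,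
      Matrix.cons_val_two, Matrix.tail_cons, Matrix.head_cons, one_pow, one_mul]
    rw [← h1, ← h2, pow_add, pow_add]
    ring
  · -- `Φ′ mod 𝔪_A ≠ 0`: the `Z^{β α₀}`-coefficient is a unit
    obtain ⟨α₀, hα₀, hm₀, hunit⟩ := hexact
    intro h0
    have hcoeff := congrArg (MvPolynomial.coeff (β α₀)) h0
    rw [MvPolynomial.coeff_map, MvPolynomial.coeff_zero, MvPolynomial.coeff_sum] at hcoeff
    simp only [MvPolynomial.coeff_monomial] at hcoeff
    rw [Finset.sum_eq_add_sum_sdiff_singleton_of_mem hα₀, if_pos rfl] at hcoeff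
    have hg₀ : g₀ α₀ = 0 ∧ g₁ α₀ = 0 := by
      constructor
      · simp only [g₀, b₀]; omega
      · simp only [g₁, b₀]; omega
    have hrest : (∑ α ∈ Φ.support \ {α₀}, if β α = β α₀ then cf α else 0) ∈ maximalIdeal A := by
      refine Ideal.sum_mem _ fun α hα => ?_
      rw [Finset.mem_sdiff, Finset.mem_singleton] at hα
      split_ifs with hβ
      · -- a support exponent with the same low part and no leftover would be `α₀` itself
        have hne : g₀ α ≠ 0 ∨ g₁ α ≠ 0 := by
          by_contra hcon
          simp only [not_or, not_not] at hcon
          apply hα.2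
          have hb : b₀ α = b₀ α₀ := by rw [← hβ0, ← hβ0, hβ]
          obtain ⟨h1, h2⟩ := hsum α hα.1
          obtain ⟨h1₀, h2₀⟩ := hsum α₀ hα₀
          have e1 : α 1 = α₀ 1 := by omega
          have e2 : α 2 = α₀ 2 := by omega
          have e0 : α 0 = α₀ 0 := by
            have d1 := apply_zero_add_eq_of_isHomogeneous hΦd hα.1
            have d2 := apply_zero_add_eq_of_isHomogeneous hΦd hα₀
            omega
          ext i
          fin_cases i
          · exact e0
          · exact e1
          · exact e2
        rcases hne with h | h
        · exact Ideal.mul_mem_right _ _ (Ideal.mul_mem_left _ _ (Ideal.pow_mem_of_mem _ (hu 0) _ (Nat.pos_of_ne_zero h)))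
        · exact Ideal.mul_mem_left _ _ (Ideal.pow_mem_of_mem _ (hu 1) _ (Nat.pos_of_ne_zero h))
      · exact zero_mem _
    have hcf₀ : cf α₀ = κ (Φ.coeff α₀) := by simp only [cf, hg₀.1, hg₀.2, pow_zero, mul_one]
    rw [map_add, (IsLocalRing.residue_eq_zero_iff _).mpr hrest, add_zero, hcf₀, IsLocalRing.residue_eq_zero_iff] at hcoeff
    exact (IsLocalRing.mem_maximalIdeal _).mp hcoeff hunit

/-- A polynomial whose reduction modulo the maximal ideal is non-zero has non-zero reduction modulo every proper ideal.
[folklore] -/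
theorem map_quotient_ne_zero_of_map_residue_ne_zero [IsLocalRing A] {σ : Type*} (Ψ : MvPolynomial σ A)
    (h : MvPolynomial.map (IsLocalRing.residue A) Ψ ≠ 0) (I : Ideal A) (hI : I ≠ ⊤) :
    MvPolynomial.map (Ideal.Quotient.mk I) Ψ ≠ 0 := by
  intro h0
  apply h
  ext n
  have hn := congrArg (MvPolynomial.coeff n) h0
  rw [MvPolynomial.coeff_map, MvPolynomial.coeff_zero, Ideal.Quotient.eq_zero_iff_mem] at hn
  rw [MvPolynomial.coeff_map, MvPolynomial.coeff_zero, IsLocalRing.residue_eq_zero_iff]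
  exact IsLocalRing.le_maximalIdeal hI hn

end Summit.ResolutionOfSingularities.ResolutionOfSingularities.Cruxes.EquisingularLiftNat.Sections.TCPlus

end
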